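import Literature.Computability.Cryptography.UOWHFTreeHashProgram
import HarnessLib

/-!
# Tree hashing of a leveled halving family, III: the level-and-block planting reduction as machines

Topic `Literature/Computability/Cryptography`; continues `UOWHFTreeHash.lean` / `UOWHFTreeHashProgram.lean` (Goldreich 2004,
§6.4.3.2, proofs of Props. 6.4.25 and 6.4.27). From a two-stage designated-collision adversary `(A₀, A)` against the tree
collection `treeHash S` (target coins `ρ ∈ {0,1}^{q(n)}`) we build the two-stage adversary `(B₀, B)` against the basic halving
collection `base S`. Its coins `r_B ∈ {0,1}^{M_Q(n)}` (`Q = q + pT + P_L + B_P`, so `n` is recovered from `|r_B|`) carry a guessed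
tree level `i < L` (binary, clamped), a guessed block `b` (binary, `|bin B_P(n)|` bits; `B_P` a polynomial bound on the number of
blocks, a parameter of the reduction), the coins `ρ` of `A₀`, and the coins `kb` of all `L` tree keys:

* `B₀(r_B)` = block `b` of level `i` of `A₀(ρ)` under the keys `kb` (the levels below `i` only use the keys below `i`);
* `B(1ⁿ, s, r_B; ω)`: splice the challenge key (the coins of `s`) into block `i` of `kb`, run `A(1ⁿ, 1ⁿ0 kb', ρ; ω)` and answer
  with block `b` of level `i` of its output under `kb'`.

Everything is given as string functions with FP bricks and value lemmas (`B0PT`, `BrunPT`, reusing the depth stage `depthP` and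
the level loop `loopT` of the evaluator: `uptoT ⟨X₂, 1ⁱ⟩ = z_i`), packaged as `redBT : RandAlg` with `isPPT_redBT`, `B0PT_mem_FP`.
The success analysis is the next file. All statements proved; no named facts.

## References

* O. Goldreich, *Foundations of Cryptography II*, CUP 2004, §6.4.3.2, proofs of Prop. 6.4.25 ("uniformly select one of the
  blocks") and Prop. 6.4.27 (planting at a uniformly selected level, as in Prop. 6.4.23).
* M. Naor, M. Yung, STOC 1989, §2.
-/

namespace Literature.Computability.Cryptography

namespace TreeHash

open _root_.Computability Complexity Complexity.Brick Complexity.Plumb Complexity.BitCodec Polynomial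
open HHRVW (catF catF_apply catF_mem_FP fitLen splice spliceP spliceP_apply spliceP_mem_FP length_splice)
open MDCompose (pShaped pShaped_index_run pShaped_hash nOf_length_idx length_index_pShaped Xrec CnF CkbF CxF XnF_X XkF_X XxF_X
  XnF_mem_FP XkF_mem_FP XxF_mem_FP Prec Prec_fst Prec_snd ksOf bFn bFn_mem_FP)

/-! ### String semantics of the reduction -/

section Strings

variable (S : TSpec) (q BP : Polynomial ℕ) (A₀ : List Bool → List Bool) (A : RandAlg (List Bool) (List Bool))

/-- Bits of the level guess: `|bin L(n)|`. [folklore] -/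
def aLb (n : ℕ) : ℕ := (encodeNat (S.L n)).length

/-- Bits of the block guess: `|bin B_P(n)|`. [folklore] -/
def aBb (n : ℕ) : ℕ := (encodeNat (BP.eval n)).length

/-- The coin polynomial of `B` is `M_Q` with `Q = q + pT + P_L + B_P`. [folklore] -/
noncomputable def QB : Polynomial ℕ := q + S.pT + S.PL + BP

/-- The guessed level `i = min(⟦field⟧, L − 1)`. [cite: Goldreich2004, proof of Prop. 6.4.27 (with Prop. 6.4.23: "uniformly selects i")] -/
def iOf (n : ℕ) (rB : List Bool) : ℕ := min (bitsToNat (rB.take (aLb S n))) (S.L n - 1)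

/-- The guessed block `b = ⟦field⟧`. [cite: Goldreich2004, proof of Prop. 6.4.25 ("uniformly select one of the blocks")] -/
def bOf (n : ℕ) (rB : List Bool) : ℕ := bitsToNat ((rB.drop (aLb S n)).take (aBb BP n))

/-- The coins of `A₀` inside `r_B`. [folklore] -/
def ρOf (n : ℕ) (rB : List Bool) : List Bool := (rB.drop (aLb S n + aBb BP n)).take (q.eval n)

/-- The coins of the tree keys inside `r_B`. [folklore] -/
def kbOf (n : ℕ) (rB : List Bool) : List Bool := (rB.drop (aLb S n + aBb BP n + q.eval n)).take (S.pT.eval n)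

/-- **`B₀` at level `n`**: block `b` of level `i` of `A₀(ρ)` under the keys `kb`. [cite: Goldreich2004, proofs of Props. 6.4.25, 6.4.27] -/
noncomputable def tgt (n : ℕ) (rB : List Bool) : List Bool :=
  blk S n (level S n (kbOf S q BP n rB) (A₀ (ρOf S q BP n rB)) (iOf S n rB)) (bOf S BP n rB)

/-- **`B₀`** (the level read off `|r_B| = M_Q(n)`). [cite: Goldreich2004, proofs of Props. 6.4.25, 6.4.27] -/
noncomputable def B0fun (rB : List Bool) : List Bool := tgt S q BP A₀ (LenPres.nOf (QB S q BP) rB.length) rB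

/-- The tree key coins with the challenge spliced into block `i`. [cite: Goldreich2004, proof of Prop. 6.4.27] -/
def kbS (n : ℕ) (s rB : List Bool) : List Bool := splice (S.P.eval n) (iOf S n rB) (ksOf n s) (kbOf S q BP n rB)

/-- The tree index handed to `A`. [folklore] -/
def sbar (n : ℕ) (s rB : List Bool) : List Bool := ones n ++ false :: kbS S q BP n s rB

/-- `A`'s answer. [folklore] -/
def xA (n : ℕ) (s rB ω : List Bool) : List Bool := A.run (boolPair (unaryEncodeNat n) (boolPair (sbar S q BP n s rB) (ρOf S q BP n rB))) ω

/-- **`B`'s output**: block `b` of level `i` of `A`'s answer under the spliced keys. [cite: Goldreich2004, proofs of Props. 6.4.25, 6.4.27] -/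
noncomputable def outB (n : ℕ) (s rB ω : List Bool) : List Bool :=
  blk S n (level S n (kbS S q BP n s rB) (xA S q BP A n s rB ω) (iOf S n rB)) (bOf S BP n rB)

/-- The length of `A`'s input `⟨1ⁿ, ⟨s̄, ρ⟩⟩` (a function of `n`). [folklore] -/
noncomputable def lenA2 (n : ℕ) : ℕ := (boolPair (unaryEncodeNat n) (boolPair (ones (LenPres.M S.pT n)) (ones (q.eval n)))).length

/-- The length of `B`'s input `⟨1ⁿ, ⟨s, r_B⟩⟩` (a function of `n`). [folklore] -/
noncomputable def lenIn (n : ℕ) : ℕ := (boolPair (unaryEncodeNat n) (boolPair (ones (LenPres.M S.P n)) (ones (LenPres.M (QB S q BP) n)))).length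

/-- `n` from `B`'s input length (used only by the coin-length function). [folklore] -/
noncomputable def nOfIn (Lin : ℕ) : ℕ := Nat.findGreatest (fun m => lenIn S q BP m ≤ Lin) Lin

variable {S q BP A₀ A}

/-- `lenIn` is strictly increasing. [folklore] -/
theorem lenIn_strictMono : StrictMono (lenIn S q BP) := by
  refine strictMono_nat_of_lt_succ fun n => ?_
  have h1 := LenPres.M_strictMono (p := S.P) (Nat.lt_add_one n)
  have h2 := LenPres.M_strictMono (p := QB S q BP) (Nat.lt_add_one n)
  simp only [lenIn, length_boolPair, unaryEncodeNat_eq_replicate, List.length_replicate, ones]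
  omega

/-- `nOfIn (lenIn n) = n`. [folklore] -/
theorem nOfIn_lenIn (n : ℕ) : nOfIn S q BP (lenIn S q BP n) = n := by
  rw [nOfIn, Nat.findGreatest_eq_iff]
  refine ⟨lenIn_strictMono.id_le n, fun _ => le_rfl, fun m hm _ h => ?_⟩
  exact absurd h (not_le.2 (lenIn_strictMono hm))

/-- `|r_B| = M_Q(n)` determines the level. [folklore] -/
theorem nOf_QB (n : ℕ) : LenPres.nOf (QB S q BP) (LenPres.M (QB S q BP) n) = n :=
  LenPres.nOf_eq le_rfl (LenPres.M_strictMono (Nat.lt_succ_self n))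

/-- The guess fields are short: `aLb ≤ L ≤ P_L`, `aBb ≤ B_P`. [folklore] -/
theorem aLb_le (n : ℕ) : aLb S n ≤ S.L n := UExpr.blen_le (fun _ => S.L n) (UExpr.var 0)

/-- The guess fields are short. [folklore] -/
theorem aBb_le (n : ℕ) : aBb BP n ≤ BP.eval n := UExpr.blen_le (fun _ => BP.eval n) (UExpr.var 0)

/-- The coin fields fit: `aLb + aBb + q + pT ≤ M_Q(n)`. [folklore] -/
theorem fields_le (hS : S.WF) (n : ℕ) : aLb S n + aBb BP n + q.eval n + S.pT.eval n ≤ LenPres.M (QB S q BP) n := by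
  have h1 := aLb_le (S := S) n; have h2 := aBb_le (BP := BP) n; have h3 := hS.L_le n
  simp only [LenPres.M, QB, eval_add]; omega

/-- The guessed level is below `L` (for `L ≥ 1`). [folklore] -/
theorem iOf_lt {n : ℕ} (hL : 1 ≤ S.L n) (rB : List Bool) : iOf S n rB < S.L n := by
  rw [iOf]; have := min_le_right (bitsToNat (rB.take (aLb S n))) (S.L n - 1); omega

/-- `|ρ| = q n` for long enough coins. [folklore] -/
theorem length_ρOf (hS : S.WF) {n : ℕ} {rB : List Bool} (h : rB.length = LenPres.M (QB S q BP) n) : (ρOf S q BP n rB).length = q.eval n := by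
  have := fields_le (q := q) (BP := BP) hS n
  rw [ρOf, List.length_take, List.length_drop, h, min_eq_left]; omega

/-- `|kb| = pT n` for long enough coins. [folklore] -/
theorem length_kbOf (hS : S.WF) {n : ℕ} {rB : List Bool} (h : rB.length = LenPres.M (QB S q BP) n) : (kbOf S q BP n rB).length = S.pT.eval n := by
  have := fields_le (q := q) (BP := BP) hS n
  rw [kbOf, List.length_take, List.length_drop, h, min_eq_left]; omega

/-- `|kbS| = pT n` for a well-formed challenge (and `L ≥ 1`). [folklore] -/
theorem length_kbS (hS : S.WF) {n : ℕ} (hL : 1 ≤ S.L n) {s rB : List Bool} (hs : (ksOf n s).length = S.P.eval n)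
    (h : rB.length = LenPres.M (QB S q BP) n) : (kbS S q BP n s rB).length = S.pT.eval n := by
  rw [kbS, length_splice hs, length_kbOf hS h]
  rw [length_kbOf hS h]
  exact le_trans (Nat.mul_le_mul_right _ (Nat.succ_le_of_lt (iOf_lt hL rB))) (hS.pT_ge n)

end Strings

/-! ### The partial tree `⟨X₂, 1ⁱ⟩ ↦ z_i` and the block extractor -/

section Upto

variable (S : TSpec)

/-- The partial-level initialisation on `⟨X₂, 1ⁱ⟩`: `⟨X₂, ⟨bin i, ⟨1⁰, pad⟩⟩⟩`. [folklore] -/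
noncomputable def initUptoT : List Bool → List Bool :=
  fanoutFn fstF (fanoutFn (lenBinF ∘ sndF) (fanoutFn (fun _ => []) (padF ∘ fstF)))

/-- **The partial tree** `⟨X₂, 1ⁱ⟩ ↦ z_i`. [cite: Goldreich2004, proofs of Props. 6.4.25, 6.4.27] -/
noncomputable def uptoT : List Bool → List Bool := sndPow 2 ∘ loopT S ∘ initUptoT

/-- On `⟨X, 1ⁱ⟩`: the level `i` of the tree of `X = ⟨1ⁿ, ⟨kb, x⟩⟩`, `z_i`. [cite: Goldreich2004, proofs of Props. 6.4.25, 6.4.27] -/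
noncomputable def levelP : List Bool → List Bool := uptoT S ∘ fanoutFn (depthP S ∘ fstF) sndF

/-- On `⟨⟨X, 1ⁱ⟩, 1ᵇ⟩`: **block `b` of level `i`**. [cite: Goldreich2004, proofs of Props. 6.4.25, 6.4.27] -/
noncomputable def blockP : List Bool → List Bool :=
  takeFn ∘ fanoutFn (catF (S.mF ∘ CnF ∘ fstF ∘ fstF) (S.mF ∘ CnF ∘ fstF ∘ fstF))
    (dropFn ∘ fanoutFn (HashBricks.umulFn ∘ fanoutFn sndF (catF (S.mF ∘ CnF ∘ fstF ∘ fstF) (S.mF ∘ CnF ∘ fstF ∘ fstF))) (levelP S ∘ fstF))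

variable {S} {n : ℕ} {kb x : List Bool}

/-- Value of the partial-level initialisation, in range. [folklore] -/
theorem initUptoT_apply (i : ℕ) :
    initUptoT (boolPair (X2rec n kb x (dep S n x) (S.m n * 2 ^ dep S n x)) (ones i)) =
      Zrec n kb x (dep S n x) (S.m n * 2 ^ dep S n x) (encodeNat i) 0 (padStr (S.m n) x) := by
  rw [initUptoT]
  simp only [fanoutFn_apply, Function.comp_apply, fstF_boolPair, sndF_boolPair, lenBinF_apply, dep, padF_X2, Zrec]
  simp [ones]

/-- **`uptoT ⟨X₂, 1ⁱ⟩ = z_i`** for `i ≤ depth ≤ L`. [cite: Goldreich2004, proofs of Props. 6.4.25, 6.4.27] -/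
theorem uptoT_apply (hS : S.WF) (hkb : S.L n * S.P.eval n ≤ kb.length) (hx : dep S n x ≤ S.L n) {i : ℕ} (hi : i ≤ dep S n x) :
    uptoT S (boolPair (X2rec n kb x (dep S n x) (S.m n * 2 ^ dep S n x)) (ones i)) = level S n kb x i := by
  have hR : i ≤ S.PL.eval (X2rec n kb x (dep S n x) (S.m n * 2 ^ dep S n x)).length :=
    hi.trans (hx.trans ((hS.L_le n).trans (TM2Iter.eval_mono S.PL (by simp [X2rec, Xrec, ones]; omega))))
  rw [uptoT, Function.comp_apply, Function.comp_apply, initUptoT_apply, Zrec, loopT, fstF_boolPair, iterate_loopStep _ _ _ _ _ hR,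
    show padStr (S.m n) x = level S n kb x 0 from rfl, loopModel_bodyT S hS hkb hx le_rfl i 0 (by omega), Nat.zero_add,
    sndPow_succ_boolPair, sndPow_succ_boolPair, sndPow_zero_boolPair]

/-- **`levelP ⟨X, 1ⁱ⟩ = z_i`** for `x` in range and `i ≤ depth`. [cite: Goldreich2004, proofs of Props. 6.4.25, 6.4.27] -/
theorem levelP_apply (hS : S.WF) (hkb : S.L n * S.P.eval n ≤ kb.length) (hx : dep S n x ≤ S.L n) {i : ℕ} (hi : i ≤ dep S n x) :
    levelP S (boolPair (Xrec n kb x) (ones i)) = level S n kb x i := by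
  rw [levelP, Function.comp_apply, fanoutFn_apply, Function.comp_apply, fstF_boolPair, sndF_boolPair, depthP_apply S hS, tc_eq_of_le S hx,
    show depth (S.m n) x.length = dep S n x from rfl, uptoT_apply hS hkb hx hi]

/-- **`blockP ⟨⟨X, 1ⁱ⟩, 1ᵇ⟩ = blk b z_i`** for `x` in range and `i ≤ depth`. [cite: Goldreich2004, proofs of Props. 6.4.25, 6.4.27] -/
theorem blockP_apply (hS : S.WF) (hkb : S.L n * S.P.eval n ≤ kb.length) (hx : dep S n x ≤ S.L n) {i : ℕ} (hi : i ≤ dep S n x) (b : ℕ) :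
    blockP S (boolPair (boolPair (Xrec n kb x) (ones i)) (ones b)) = blk S n (level S n kb x i) b := by
  have h2m : catF (S.mF ∘ CnF ∘ fstF ∘ fstF) (S.mF ∘ CnF ∘ fstF ∘ fstF) (boolPair (boolPair (Xrec n kb x) (ones i)) (ones b)) = ones (2 * S.m n) := by
    rw [catF_apply]; simp only [Function.comp_apply, fstF_boolPair, XnF_X, hS.mF_apply]; simp [ones, two_mul]
  rw [blockP, Function.comp_apply, fanoutFn_apply, h2m, Function.comp_apply, fanoutFn_apply, Function.comp_apply, fanoutFn_apply, h2m,
    sndF_boolPair, HashBricks.umulFn_boolPair, Function.comp_apply, fstF_boolPair, levelP_apply hS hkb hx hi, dropFn_boolPair, takeFn_boolPair, blk]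
  simp [ones]

/-- `levelP ∈ FP`. [folklore] -/
theorem levelP_mem_FP (hS : S.WF) : levelP S ∈ FP := by
  have hinit : initUptoT ∈ FP := fanoutFn_mem_FP fstF_mem_FP (fanoutFn_mem_FP (comp_mem_FP lenBinF_mem_FP sndF_mem_FP)
    (fanoutFn_mem_FP (const_mem_FP _) (comp_mem_FP padF_mem_FP fstF_mem_FP)))
  have hupto : uptoT S ∈ FP := comp_mem_FP (sndPow_mem_FP 2) (comp_mem_FP
    (loopFn_mem_FP_of_poly (bodyT_mem_FP S hS) (QT S) (length_bodyT_le S) S.PL) hinit)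
  exact comp_mem_FP hupto (fanoutFn_mem_FP (comp_mem_FP (depthP_mem_FP S hS) fstF_mem_FP) sndF_mem_FP)

/-- `blockP ∈ FP`. [folklore] -/
theorem blockP_mem_FP (hS : S.WF) : blockP S ∈ FP := by
  have h2m : catF (S.mF ∘ CnF ∘ fstF ∘ fstF) (S.mF ∘ CnF ∘ fstF ∘ fstF) ∈ FP :=
    catF_mem_FP (comp_mem_FP hS.mF_mem (comp_mem_FP XnF_mem_FP (comp_mem_FP fstF_mem_FP fstF_mem_FP)))
      (comp_mem_FP hS.mF_mem (comp_mem_FP XnF_mem_FP (comp_mem_FP fstF_mem_FP fstF_mem_FP)))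
  exact comp_mem_FP takeFn_mem_FP (fanoutFn_mem_FP h2m (comp_mem_FP dropFn_mem_FP (fanoutFn_mem_FP
    (comp_mem_FP HashBricks.umulFn_mem_FP (fanoutFn_mem_FP sndF_mem_FP h2m)) (comp_mem_FP (levelP_mem_FP hS) fstF_mem_FP))))

end Upto

/-! ### Parsing the coins of `B` -/

section Parse

variable (S : TSpec) (q BP : Polynomial ℕ) (A₀ : List Bool → List Bool) (A : RandAlg (List Bool) (List Bool))

/-- The size expression `2^{|bin v|}` (a named constant, so that `compile₁` stays folded). [folklore] -/
def Epow : UExpr := UExpr.pow2 (UExpr.var 0)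

/-- On the pair record `P = ⟨1ⁿ, r_B⟩`: `1^{aLb n}`. [folklore] -/
noncomputable def aLbU : List Bool → List Bool := onesFn ∘ lenBinF ∘ S.LF ∘ fstF
/-- On `P`: `1^{aBb n}`. [folklore] -/
noncomputable def aBbU : List Bool → List Bool := onesFn ∘ lenBinF ∘ polyFn BP ∘ fstF
/-- On `P`: `1^{L − 1}`. [folklore] -/
noncomputable def Lm1U : List Bool → List Bool := dropFn ∘ fanoutFn (fun _ => [true]) (S.LF ∘ fstF)
/-- On `P`: the guessed level `1ⁱ`. [cite: Goldreich2004, proof of Prop. 6.4.27] -/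
noncomputable def liU : List Bool → List Bool := binToUnaryFn ∘ fanoutFn (Lm1U S) (takeFn ∘ fanoutFn (aLbU S) sndF)
/-- On `P`: `1^{2^{aBb}}` (the clamp of the block guess, never active). [folklore] -/
noncomputable def bBoundU : List Bool → List Bool := UExpr.compile₁ Epow ∘ polyFn BP ∘ fstF
/-- On `P`: the guessed block `1ᵇ`. [cite: Goldreich2004, proof of Prop. 6.4.25] -/
noncomputable def bU : List Bool → List Bool :=
  binToUnaryFn ∘ fanoutFn (bBoundU BP) (takeFn ∘ fanoutFn (aBbU BP) (dropFn ∘ fanoutFn (aLbU S) sndF))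
/-- On `P`: the coins `ρ`. [folklore] -/
noncomputable def ρF : List Bool → List Bool := takeFn ∘ fanoutFn (polyFn q ∘ fstF) (dropFn ∘ fanoutFn (catF (aLbU S) (aBbU BP)) sndF)
/-- On `P`: the key coins `kb`. [folklore] -/
noncomputable def kbF : List Bool → List Bool :=
  takeFn ∘ fanoutFn (polyFn S.pT ∘ fstF) (dropFn ∘ fanoutFn (catF (catF (aLbU S) (aBbU BP)) (polyFn q ∘ fstF)) sndF)

variable {S q BP A₀ A} {n : ℕ} {rB : List Bool}

/-- Value of `aLbU`. [folklore] -/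
theorem aLbU_P (hS : S.WF) : aLbU S (Prec n rB) = ones (aLb S n) := by
  simp only [aLbU, Function.comp_apply, Prec_fst, hS.LF_apply, lenBinF_apply, onesFn_eq_ones, aLb]; simp [ones]
/-- Value of `aBbU`. [folklore] -/
theorem aBbU_P : aBbU BP (Prec n rB) = ones (aBb BP n) := by
  simp only [aBbU, Function.comp_apply, Prec_fst, polyFn_apply, lenBinF_apply, onesFn_eq_ones, aBb]; simp [ones]
/-- Value of `Lm1U`. [folklore] -/
theorem Lm1U_P (hS : S.WF) : Lm1U S (Prec n rB) = ones (S.L n - 1) := by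
  simp only [Lm1U, Function.comp_apply, fanoutFn_apply, Prec_fst, hS.LF_apply, dropFn_boolPair]; simp [ones]
/-- Value of `liU`. [folklore] -/
theorem liU_P (hS : S.WF) : liU S (Prec n rB) = ones (iOf S n rB) := by
  simp only [liU, Function.comp_apply, fanoutFn_apply, Lm1U_P hS, aLbU_P hS, Prec_snd, takeFn_boolPair, binToUnaryFn_boolPair, iOf]
  simp [ones]
/-- Value of `bBoundU`. [folklore] -/
theorem bBoundU_P : bBoundU BP (Prec n rB) = ones (2 ^ aBb BP n) := by
  simp only [bBoundU, Function.comp_apply, Prec_fst, polyFn_apply, UExpr.compile₁_apply, Epow, UExpr.eval_pow2, UExpr.eval_var, aBb]; simp [ones]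
/-- Value of `bU`. [folklore] -/
theorem bU_P (hS : S.WF) : bU S BP (Prec n rB) = ones (bOf S BP n rB) := by
  simp only [bU, Function.comp_apply, fanoutFn_apply, bBoundU_P, aBbU_P, aLbU_P hS, Prec_snd, dropFn_boolPair, takeFn_boolPair,
    binToUnaryFn_boolPair, bOf]
  simp only [ones, List.length_replicate]
  rw [min_eq_left]
  exact (Nat.le_of_lt_succ (Nat.lt_succ_of_lt ((bitsToNat_lt _).trans_le (Nat.pow_le_pow_right (by norm_num)
    (by rw [List.length_take]; exact min_le_left _ _)))))
/-- Value of `ρF`. [folklore] -/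
theorem ρF_P (hS : S.WF) : ρF S q BP (Prec n rB) = ρOf S q BP n rB := by
  simp only [ρF, Function.comp_apply, fanoutFn_apply, catF_apply, aLbU_P hS, aBbU_P, Prec_fst, Prec_snd, polyFn_apply, dropFn_boolPair,
    takeFn_boolPair, ρOf]
  simp [ones]
/-- Value of `kbF`. [folklore] -/
theorem kbF_P (hS : S.WF) : kbF S q BP (Prec n rB) = kbOf S q BP n rB := by
  simp only [kbF, Function.comp_apply, fanoutFn_apply, catF_apply, aLbU_P hS, aBbU_P, Prec_fst, Prec_snd, polyFn_apply, dropFn_boolPair,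
    takeFn_boolPair, kbOf]
  simp [ones, Nat.add_assoc]

/-- `aLbU ∈ FP`. [folklore] -/
theorem aLbU_mem_FP (hS : S.WF) : aLbU S ∈ FP := comp_mem_FP onesFn_mem_FP (comp_mem_FP lenBinF_mem_FP (comp_mem_FP hS.LF_mem fstF_mem_FP))
/-- `aBbU ∈ FP`. [folklore] -/
theorem aBbU_mem_FP : aBbU BP ∈ FP := comp_mem_FP onesFn_mem_FP (comp_mem_FP lenBinF_mem_FP (comp_mem_FP (polyFn_mem_FP _) fstF_mem_FP))
/-- `liU ∈ FP`. [folklore] -/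
theorem liU_mem_FP (hS : S.WF) : liU S ∈ FP :=
  comp_mem_FP binToUnaryFn_mem_FP (fanoutFn_mem_FP (comp_mem_FP dropFn_mem_FP (fanoutFn_mem_FP (const_mem_FP _) (comp_mem_FP hS.LF_mem fstF_mem_FP)))
    (comp_mem_FP takeFn_mem_FP (fanoutFn_mem_FP (aLbU_mem_FP hS) sndF_mem_FP)))
/-- `bU ∈ FP`. [folklore] -/
theorem bU_mem_FP (hS : S.WF) : bU S BP ∈ FP :=
  comp_mem_FP binToUnaryFn_mem_FP (fanoutFn_mem_FP (comp_mem_FP (UExpr.compile₁_mem_FP _) (comp_mem_FP (polyFn_mem_FP _) fstF_mem_FP))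
    (comp_mem_FP takeFn_mem_FP (fanoutFn_mem_FP aBbU_mem_FP (comp_mem_FP dropFn_mem_FP (fanoutFn_mem_FP (aLbU_mem_FP hS) sndF_mem_FP)))))
/-- `ρF ∈ FP`. [folklore] -/
theorem ρF_mem_FP (hS : S.WF) : ρF S q BP ∈ FP :=
  comp_mem_FP takeFn_mem_FP (fanoutFn_mem_FP (comp_mem_FP (polyFn_mem_FP _) fstF_mem_FP)
    (comp_mem_FP dropFn_mem_FP (fanoutFn_mem_FP (catF_mem_FP (aLbU_mem_FP hS) aBbU_mem_FP) sndF_mem_FP)))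
/-- `kbF ∈ FP`. [folklore] -/
theorem kbF_mem_FP (hS : S.WF) : kbF S q BP ∈ FP :=
  comp_mem_FP takeFn_mem_FP (fanoutFn_mem_FP (comp_mem_FP (polyFn_mem_FP _) fstF_mem_FP)
    (comp_mem_FP dropFn_mem_FP (fanoutFn_mem_FP (catF_mem_FP (catF_mem_FP (aLbU_mem_FP hS) aBbU_mem_FP) (comp_mem_FP (polyFn_mem_FP _) fstF_mem_FP)) sndF_mem_FP)))

end Parse

/-! ### The two machines -/

section Machines

variable (S : TSpec) (q BP : Polynomial ℕ) (A₀ : List Bool → List Bool) (A : RandAlg (List Bool) (List Bool))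

/-- **The brick of `B₀`** on `r_B`: pair record `⟨1^{nOf Q |r_B|}, r_B⟩`, then block `b` of level `i` of `A₀ ρ` under `kb`.
[cite: Goldreich2004, proofs of Props. 6.4.25, 6.4.27] -/
noncomputable def B0PT : List Bool → List Bool :=
  blockP S ∘ fanoutFn (fanoutFn (fanoutFn fstF (fanoutFn (kbF S q BP) (A₀ ∘ ρF S q BP))) (liU S)) (bU S BP) ∘ fanoutFn (LenPres.nOfFn (QB S q BP)) id

/-- On `B`'s record `W = ⟨⟨1ⁿ, ⟨s, r_B⟩⟩, ω⟩`: the pair record `⟨1ⁿ, r_B⟩`. [folklore] -/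
noncomputable def WPF : List Bool → List Bool := fanoutFn (fstF ∘ fstF) (sndPow 1 ∘ fstF)
/-- On `W`: the coins `ks` of the challenge index, `s ⇂ (n+1)`. [folklore] -/
noncomputable def WksF : List Bool → List Bool := dropFn ∘ fanoutFn (catF (fstF ∘ fstF) fun _ => [true]) (nthF 1 ∘ fstF)
/-- On `W`: the spliced key coins `kb'`. [cite: Goldreich2004, proof of Prop. 6.4.27] -/
noncomputable def WkbF : List Bool → List Bool :=
  spliceP ∘ fanoutFn (polyFn S.P ∘ fstF ∘ fstF) (fanoutFn (liU S ∘ WPF) (fanoutFn WksF (kbF S q BP ∘ WPF)))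
/-- On `W`: the tree index `1ⁿ 0 kb'`. [folklore] -/
noncomputable def WsbarF : List Bool → List Bool := catF (fstF ∘ fstF) (List.cons false ∘ WkbF S q BP)
/-- On `W`: `A`'s answer. [folklore] -/
noncomputable def WxF : List Bool → List Bool := bFn A ∘ fanoutFn (fanoutFn (fstF ∘ fstF) (fanoutFn (WsbarF S q BP) (ρF S q BP ∘ WPF))) sndF

/-- **The brick of `B`** on `Z`: block `b` of level `i` of `A`'s answer under `kb'`. [cite: Goldreich2004, proofs of Props. 6.4.25, 6.4.27] -/
noncomputable def BrunPT : List Bool → List Bool :=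
  blockP S ∘ fanoutFn (fanoutFn (fanoutFn (fstF ∘ fstF) (fanoutFn (WkbF S q BP) (WxF S q BP A))) (liU S ∘ WPF)) (bU S BP ∘ WPF)

/-- `B`'s record. [folklore] -/
def Win (n : ℕ) (rB s ω : List Bool) : List Bool := boolPair (boolPair (unaryEncodeNat n) (boolPair s rB)) ω

/-- **The second stage `B`** of the reduction: run function `BrunPT`, coins = those of `A` on the tree query. [cite: Goldreich2004, proof of Prop. 6.4.27] -/
noncomputable def redBT : RandAlg (List Bool) (List Bool) where
  run inp ω := BrunPT S q BP A (boolPair inp ω)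
  coinLen Lin := A.coinLen (lenA2 S q (nOfIn S q BP Lin))

variable {S q BP A₀ A} {n : ℕ} {rB s ω : List Bool}

/-- The pair record of `B₀`. [folklore] -/
theorem B0_prec (rB : List Bool) : fanoutFn (LenPres.nOfFn (QB S q BP)) id rB = Prec (LenPres.nOf (QB S q BP) rB.length) rB := by
  rw [fanoutFn_apply, LenPres.nOfFn_apply, id, Prec]

/-- **Value of `B0PT`** on well-formed coins, when `A₀`'s target is in range and the guessed level is within its depth
(else junk of no import): `B0PT r_B = B0fun r_B`. [cite: Goldreich2004, proofs of Props. 6.4.25, 6.4.27] -/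
theorem B0PT_apply (hS : S.WF) (hrB : rB.length = LenPres.M (QB S q BP) n)
    (hx : dep S n (A₀ (ρOf S q BP n rB)) ≤ S.L n) (hi : iOf S n rB ≤ dep S n (A₀ (ρOf S q BP n rB))) :
    B0PT S q BP A₀ rB = B0fun S q BP A₀ rB := by
  have hn : LenPres.nOf (QB S q BP) rB.length = n := by rw [hrB]; exact nOf_QB n
  have hkb : S.L n * S.P.eval n ≤ (kbOf S q BP n rB).length := by rw [length_kbOf hS hrB]; exact hS.pT_ge n
  rw [B0PT, Function.comp_apply, Function.comp_apply, B0_prec, hn, fanoutFn_apply, fanoutFn_apply, fanoutFn_apply, fanoutFn_apply, Function.comp_apply,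
    liU_P hS, bU_P hS, kbF_P hS, ρF_P hS, Prec_fst,
    show boolPair (ones n) (boolPair (kbOf S q BP n rB) (A₀ (ρOf S q BP n rB))) = Xrec n (kbOf S q BP n rB) (A₀ (ρOf S q BP n rB)) from rfl,
    blockP_apply hS hkb hx hi, B0fun, hn, tgt]

/-- `B0PT ∈ FP` for `A₀ ∈ FP`. [cite: Goldreich2004, proofs of Props. 6.4.25, 6.4.27 ("polynomial-time")] -/
theorem B0PT_mem_FP (hS : S.WF) (hA₀ : A₀ ∈ FP) : B0PT S q BP A₀ ∈ FP :=
  comp_mem_FP (blockP_mem_FP hS) (comp_mem_FP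
    (fanoutFn_mem_FP (fanoutFn_mem_FP (fanoutFn_mem_FP fstF_mem_FP (fanoutFn_mem_FP (kbF_mem_FP hS) (comp_mem_FP hA₀ (ρF_mem_FP hS)))) (liU_mem_FP hS))
      (bU_mem_FP hS))
    (fanoutFn_mem_FP (LenPres.nOfFn_mem_FP _) (PolyTimeComputable.id _)))

/-- Accessor values on `W`. [folklore] -/
theorem WPF_W : WPF (Win n rB s ω) = Prec n rB := by
  simp [WPF, Win, Prec, unaryEncodeNat_eq_replicate]
/-- Accessor values on `W`. [folklore] -/
theorem Wn_W : (fstF ∘ fstF) (Win n rB s ω) = ones n := by simp [Win, unaryEncodeNat_eq_replicate, ones]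
/-- Accessor values on `W`. [folklore] -/
theorem WksF_W : WksF (Win n rB s ω) = ksOf n s := by
  rw [WksF, Function.comp_apply, fanoutFn_apply, catF_apply, Wn_W]
  simp [Win, nthF, ones, ksOf]
/-- Accessor values on `W`. [folklore] -/
theorem WkbF_W (hS : S.WF) : WkbF S q BP (Win n rB s ω) = kbS S q BP n s rB := by
  rw [WkbF, Function.comp_apply, fanoutFn_apply, fanoutFn_apply, fanoutFn_apply, Function.comp_apply, Wn_W, polyFn_apply,
    Function.comp_apply, WPF_W, liU_P hS, WksF_W, Function.comp_apply, WPF_W, kbF_P hS]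
  simp only [ones, List.length_replicate]
  rw [← ones, ← ones, spliceP_apply, kbS]
/-- Accessor values on `W`. [folklore] -/
theorem WsbarF_W (hS : S.WF) : WsbarF S q BP (Win n rB s ω) = sbar S q BP n s rB := by
  rw [WsbarF, catF_apply, Wn_W, Function.comp_apply, WkbF_W hS, sbar]
/-- Accessor values on `W`. [folklore] -/
theorem WxF_W (hS : S.WF) : WxF S q BP A (Win n rB s ω) = xA S q BP A n s rB ω := by
  rw [WxF, Function.comp_apply, fanoutFn_apply, fanoutFn_apply, fanoutFn_apply, Wn_W, WsbarF_W hS, Function.comp_apply, WPF_W, ρF_P hS, bFn,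
    Function.comp_apply]
  simp [Win, xA, unaryEncodeNat_eq_replicate, ones]

/-- **Value of `BrunPT`** on well-formed records, when `A`'s answer is in range and the guessed level is within its depth.
[cite: Goldreich2004, proofs of Props. 6.4.25, 6.4.27] -/
theorem BrunPT_apply (hS : S.WF) (hL : 1 ≤ S.L n) (hrB : rB.length = LenPres.M (QB S q BP) n) (hs : (ksOf n s).length = S.P.eval n)
    (hx : dep S n (xA S q BP A n s rB ω) ≤ S.L n) (hi : iOf S n rB ≤ dep S n (xA S q BP A n s rB ω)) :
    BrunPT S q BP A (Win n rB s ω) = outB S q BP A n s rB ω := by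
  have hkb : S.L n * S.P.eval n ≤ (kbS S q BP n s rB).length := by rw [length_kbS hS hL hs hrB]; exact hS.pT_ge n
  rw [BrunPT, Function.comp_apply, fanoutFn_apply, fanoutFn_apply, fanoutFn_apply, fanoutFn_apply, Wn_W, WkbF_W hS, WxF_W hS, Function.comp_apply,
    WPF_W, liU_P hS, Function.comp_apply, WPF_W, bU_P hS,
    show boolPair (ones n) (boolPair (kbS S q BP n s rB) (xA S q BP A n s rB ω)) = Xrec n (kbS S q BP n s rB) (xA S q BP A n s rB ω) from rfl,
    blockP_apply hS hkb hx hi, outB]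

/-- `BrunPT ∈ FP` for PPT `A`. [cite: Goldreich2004, proofs of Props. 6.4.25, 6.4.27 ("polynomial-time")] -/
theorem BrunPT_mem_FP (hS : S.WF) (hA : IsPPT A id) : BrunPT S q BP A ∈ FP := by
  have hP : WPF ∈ FP := fanoutFn_mem_FP (comp_mem_FP fstF_mem_FP fstF_mem_FP) (comp_mem_FP (sndPow_mem_FP 1) fstF_mem_FP)
  have hn : fstF ∘ fstF ∈ FP := comp_mem_FP fstF_mem_FP fstF_mem_FP
  have hks : WksF ∈ FP := comp_mem_FP dropFn_mem_FP (fanoutFn_mem_FP (catF_mem_FP hn (const_mem_FP _)) (comp_mem_FP (nthF_mem_FP 1) fstF_mem_FP))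
  have hkb : WkbF S q BP ∈ FP := comp_mem_FP spliceP_mem_FP (fanoutFn_mem_FP (comp_mem_FP (polyFn_mem_FP _) hn)
    (fanoutFn_mem_FP (comp_mem_FP (liU_mem_FP hS) hP) (fanoutFn_mem_FP hks (comp_mem_FP (kbF_mem_FP hS) hP))))
  have hsb : WsbarF S q BP ∈ FP := catF_mem_FP hn (comp_mem_FP (cons_mem_FP false) hkb)
  have hxA : WxF S q BP A ∈ FP := comp_mem_FP (bFn_mem_FP A hA) (fanoutFn_mem_FP (fanoutFn_mem_FP hn (fanoutFn_mem_FP hsb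
    (comp_mem_FP (ρF_mem_FP hS) hP))) sndF_mem_FP)
  exact comp_mem_FP (blockP_mem_FP hS) (fanoutFn_mem_FP (fanoutFn_mem_FP (fanoutFn_mem_FP hn (fanoutFn_mem_FP hkb hxA)) (comp_mem_FP (liU_mem_FP hS) hP))
    (comp_mem_FP (bU_mem_FP hS) hP))

/-- The run of `B` is its brick on the paired input (by `simp`, avoiding a costly definitional unfolding). [folklore] -/
theorem redBT_run_eq (inp ω : List Bool) : (redBT S q BP A).run inp ω = BrunPT S q BP A (boolPair inp ω) := by
  simp only [redBT]

/-- The coin count of `B`. [folklore] -/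
theorem redBT_coinLen_eq (Lin : ℕ) : (redBT S q BP A).coinLen Lin = A.coinLen (lenA2 S q (nOfIn S q BP Lin)) := by
  simp only [redBT]

/-- `B`'s run on the experiment's input equals `outB` (well-formed, in-range case). [cite: Goldreich2004, proof of Prop. 6.4.27] -/
theorem redBT_run (hS : S.WF) (hL : 1 ≤ S.L n) (hrB : rB.length = LenPres.M (QB S q BP) n) (hs : (ksOf n s).length = S.P.eval n)
    (hx : dep S n (xA S q BP A n s rB ω) ≤ S.L n) (hi : iOf S n rB ≤ dep S n (xA S q BP A n s rB ω)) :
    (redBT S q BP A).run (boolPair (unaryEncodeNat n) (boolPair s rB)) ω = outB S q BP A n s rB ω := by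
  rw [redBT_run_eq]
  exact BrunPT_apply hS hL hrB hs hx hi

/-- The coin count of `B` on the experiment's input is `A`'s coin count on the tree query. [folklore] -/
theorem redBT_coinLen (n : ℕ) {s rB : List Bool} (hs : s.length = LenPres.M S.P n) (hrB : rB.length = LenPres.M (QB S q BP) n) :
    (redBT S q BP A).coinLen (boolPair (unaryEncodeNat n) (boolPair s rB)).length = A.coinLen (lenA2 S q n) := by
  rw [redBT_coinLen_eq]
  have : (boolPair (unaryEncodeNat n) (boolPair s rB)).length = lenIn S q BP n := by
    simp only [lenIn, length_boolPair, hs, hrB, ones, List.length_replicate]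
  rw [this, nOfIn_lenIn]

/-- **`B` is PPT** for PPT `A`. [cite: Goldreich2004, proof of Prop. 6.4.27] -/
theorem isPPT_redBT (hS : S.WF) (hA : IsPPT A id) : IsPPT (redBT S q BP A) id := by
  refine ⟨?_, ?_⟩
  · have e : Function.uncurry (redBT S q BP A).run = fun z => BrunPT S q BP A (boolPair z.1 z.2) := by
      funext z; simp only [Function.uncurry, redBT_run_eq]
    rw [e]
    obtain ⟨pc, Mc, hM⟩ := BrunPT_mem_FP (S := S) (q := q) (BP := BP) hS hA
    exact ⟨pc, Mc, fun z => hM (boolPair z.1 z.2)⟩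
  · obtain ⟨qA, hqA⟩ := hA.2
    refine ⟨qA.comp (C 2 * Polynomial.X + C 4 + C 2 * (S.pT + Polynomial.X + 1) + q), fun Lin => ?_⟩
    have hn : nOfIn S q BP Lin ≤ Lin := Nat.findGreatest_le _
    have hlen : lenA2 S q (nOfIn S q BP Lin) = 2 * nOfIn S q BP Lin + 4 + 2 * LenPres.M S.pT (nOfIn S q BP Lin) + q.eval (nOfIn S q BP Lin) := by
      simp only [lenA2, length_boolPair, unaryEncodeNat_eq_replicate, List.length_replicate, ones]; ring
    rw [redBT_coinLen_eq]
    refine (hqA _).trans (TM2Iter.eval_mono qA ?_) |>.trans (le_of_eq (by rw [Polynomial.eval_comp]))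
    rw [hlen, LenPres.M]
    simp only [Polynomial.eval_add, Polynomial.eval_mul, Polynomial.eval_C, Polynomial.eval_X, Polynomial.eval_one]
    have h1 := TM2Iter.eval_mono S.pT hn; have h2 := TM2Iter.eval_mono q hn
    omega

end Machines

end TreeHash

end Literature.Computability.Cryptography
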